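import Summits.Ventures.HodgeRepro2.T5HermitianGlobalChain
import Summits.Ventures.HodgeRepro2.T5GramIsometry
import Summits.Ventures.HodgeRepro2.T5GramSignature
import Summits.Ventures.HodgeRepro2.T5FinitePlaceCM
import Summits.Ventures.HodgeRepro2.T6N2Hyp

/-!
# Shimura's Theorem 2.2 (i) from the Hasse principle: the invariants `(n, {σ_v}, d₀)` through the kernel local
classification — the cell's two Landherr displays are ONE (cell pub-hodge-repro2, seat p3)

Tier-5 N2 support, rows N2.2.7 / N2.2.9 / N2.8.1 of route/T5-N2-route-3.md. The cell holds two displays of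
Landherr's theorem: seat t6-p5's `T6.Hyp.Shimura2008_Thm2_2_i K` (Shimura, Doc. Math. 13 (2008) Thm 2.2 (i):
«the isomorphism class of (V, ϕ) is determined by n, {σ_v}, and d₀(ϕ)», rendered on the rank-2 diagonal forms
`pairForm c₁ c₂` with the determinant condition `c₁ c₂ = c₁' c₂' · z z̄`) and file 156's
`T5HermitianGlobalChain.GrossBH2021_Thm3_1_uniqueness K n` (Gross, Thm 3.1 last sentence / Shimura Thm 2.2 (i): the
Hasse principle — congruent at every place ⇒ congruent). Shimura's printed proof of (i) reads ‹Clearly n and {σ_v}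
determine (V, ϕ)_v for every v ∈ a, and n and d₀(ϕ) determine (V, ϕ)_v for every v ∈ h by Lemma 1.6. Therefore we
obtain (i) in view of the Hasse principle.› (quoted in 156's display). This file puts that proof in the kernel:
* `exists_datum`: every CM field `K` carries a datum `(θ, y)` — `K = K⁺(y)`, `y² = θ ∈ K⁺`, `c(y) = −y ≠ y`
  (`y := y₀ − c(y₀)` for any `y₀ ∉ K⁺`, Mathlib's `complexConj_ne_one`);
* `exists_eq_add_mul`, `mul_star_eq_sub`, `exists_isNormSqrt_mul_star`: every `z ∈ K` is `a + b y` with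
  `a, b ∈ K⁺`, and its norm `z · star z` is `a² − θ b²` — a Hilbert norm form value in `K⁺` (file 133's
  `IsNormSqrt`);
* **`locallyCongruent_all_of_isNormSqrt`** — «n and d₀ determine (V, ϕ)_v for every v ∈ h»: two invertible
  hermitian Gram matrices over `K` whose determinant ratio `c ∈ K⁺` is a global norm (`IsNormSqrt θ c`) are
  congruent over `K⁺_v ⊗ K` at EVERY finite place `v` of `K⁺` — `(c, θ)_v = 1` because `c` is a norm
  (file 133's `hilbertSolvable_of_isNormSqrt`), and `(c, θ)_v = 1 ⟺` local congruence (files 146–156);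
  `locallyCongruent_all_of_det_eq` (equal determinants) and `locallyCongruent_all_of_det_eq_mul_norm`
  (`det H' = z z̄ · det H`) are the two forms used;
* **`isCongruent_of_det_eq_mul_norm`** / `isCongruent_of_det_eq` — Shimura's (i) in Gram form: same `n`, same
  `d₀` (`det H' = z z̄ · det H`), same signatures (congruent under every `φ : K → ℂ`) ⇒ congruent over `K`, from
  the Hasse principle `GrossBH2021_Thm3_1_uniqueness K n` ALONE;
* **`shimura2008_Thm2_2_i_of_grossBH2021`** — THE DISPLAY IMPLICATION: `GrossBH2021_Thm3_1_uniqueness K (Fin 2)`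
  implies `T6.Hyp.Shimura2008_Thm2_2_i K` (with 158's «equal sign sums ⇒ congruent over ℂ» at the real places and
  157's bridge to `pairForm`). Consequence: every consumer of t6-p5's display runs on the Hasse-principle display
  instead, and the selection-rule / reciprocity inputs of 156's chain are NOT needed when the two forms have the
  same determinant class — in particular on t6-p5's datum forms `⟨1, r⟩`, `⟨u, u⁻¹ r⟩` (same determinant `r`).

Mathlib + t6-p5's accepted T6N2Hyp (the display, consumed by name, never re-declared) + this seat's files 133 /
134 / 146 / 154–158 and their imports; no new display; no device. §8(d): uses an L-value-free non-vanishing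
device: NO.
-/

namespace Summit.Ventures.HodgeRepro2.T5LandherrInvariants

open IsDedekindDomain IsDedekindDomain.HeightOneSpectrum NumberField NumberField.IsCMField Matrix
open Summit.Ventures.HodgeRepro2.T5HermitianDetClass Summit.Ventures.HodgeRepro2.T5HilbertSymbolNorm
  Summit.Ventures.HodgeRepro2.T5HilbertSymbolPlaces Summit.Ventures.HodgeRepro2.T5HermitianGlobalChain
  Summit.Ventures.HodgeRepro2.T5FinitePlaceCM Summit.Ventures.HodgeRepro2.T5GramIsometry
  Summit.Ventures.HodgeRepro2.T5GramSignature Summit.Ventures.HodgeRepro2.T5DatumSimilitude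

/-! ## Every CM field carries a datum `(θ, y)` -/

section Datum

variable (K : Type*) [Field K] [NumberField K] [IsCMField K]

/-- **Every CM field carries a datum `(θ, y)` of the route:** `y ∈ K` with `y² = θ ∈ K⁺` and `c(y) ≠ y`
(so `K = K⁺(y)`, files 146 ff.). Take `y := y₀ − c(y₀)` for any `y₀` moved by `c` (`complexConj_ne_one`). -/
theorem exists_datum : ∃ (θ : maximalRealSubfield K) (y : K),
    algebraMap (maximalRealSubfield K) K θ = y ^ 2 ∧ complexConj K y ≠ y := by
  have h1 : ∃ y₀ : K, complexConj K y₀ ≠ y₀ := by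
    by_contra h
    refine complexConj_ne_one K (AlgEquiv.ext fun x => ?_)
    rw [AlgEquiv.one_apply]
    exact not_not.mp (not_exists.mp h x)
  obtain ⟨y₀, hy₀⟩ := h1
  set y := y₀ - complexConj K y₀ with hy
  have hcy : complexConj K y = -y := by
    rw [hy, map_sub, complexConj_apply_apply]
    ring
  have hy0 : y ≠ 0 := by
    rw [hy]
    exact sub_ne_zero.mpr (Ne.symm hy₀)
  have hsq : y ^ 2 ∈ maximalRealSubfield K := by
    rw [← complexConj_eq_self_iff, map_pow, hcy]
    ring
  refine ⟨⟨y ^ 2, hsq⟩, y, rfl, ?_⟩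
  rw [hcy]
  intro h
  apply hy0
  have h2 : (2 : K) * y = 0 := by linear_combination -h
  rcases mul_eq_zero.mp h2 with h3 | h3
  · exact absurd h3 two_ne_zero
  · exact h3

end Datum

/-! ## The norm of `K/K⁺` is the Hilbert norm form `a² − θ b²` -/

section Norm

variable {K : Type*} [Field K] [NumberField K] [IsCMField K]
variable {θ : maximalRealSubfield K} {y : K}
  (hθ : algebraMap (maximalRealSubfield K) K θ = y ^ 2) (hy : complexConj K y ≠ y)

include hy in
/-- Every `z ∈ K` is `a + b y` with `a, b ∈ K⁺` (file 146's `span_pair_eq_top`). -/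
theorem exists_eq_add_mul (z : K) : ∃ a b : maximalRealSubfield K,
    z = algebraMap (maximalRealSubfield K) K a + algebraMap (maximalRealSubfield K) K b * y := by
  have hz : z ∈ Submodule.span (maximalRealSubfield K) {(1 : K), y} := by
    rw [span_pair_eq_top K hy]
    exact Submodule.mem_top
  obtain ⟨a, b, hab⟩ := Submodule.mem_span_pair.mp hz
  refine ⟨a, b, ?_⟩
  rw [← hab, Algebra.smul_def, Algebra.smul_def, mul_one]

include hθ hy in
/-- `(a + b y) · star (a + b y) = a² − θ b²` for `a, b ∈ K⁺` (`star y = −y`). -/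
theorem mul_star_eq_sub (a b : maximalRealSubfield K) :
    (algebraMap (maximalRealSubfield K) K a + algebraMap (maximalRealSubfield K) K b * y) *
      star (algebraMap (maximalRealSubfield K) K a + algebraMap (maximalRealSubfield K) K b * y) =
      algebraMap (maximalRealSubfield K) K (a ^ 2 - θ * b ^ 2) := by
  have hsy : star y = -y := complexConj_apply_eq_neg K hθ hy
  have hsa : star (algebraMap (maximalRealSubfield K) K a) = algebraMap (maximalRealSubfield K) K a :=
    complexConj_apply_eq_self K a
  have hsb : star (algebraMap (maximalRealSubfield K) K b) = algebraMap (maximalRealSubfield K) K b :=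
    complexConj_apply_eq_self K b
  rw [star_add, star_mul, hsy, hsa, hsb, map_sub, map_mul, map_pow, map_pow, hθ]
  ring

include hθ hy in
/-- **The norm `z · star z` of `z ∈ K` is a Hilbert norm form value in `K⁺`:** it is the image of some `c ∈ K⁺`
with `c = a² − θ b²` (file 133's `IsNormSqrt θ c`). -/
theorem exists_isNormSqrt_mul_star (z : K) : ∃ c : maximalRealSubfield K,
    algebraMap (maximalRealSubfield K) K c = z * star z ∧ IsNormSqrt θ c := by
  obtain ⟨a, b, rfl⟩ := exists_eq_add_mul hy z
  exact ⟨a ^ 2 - θ * b ^ 2, (mul_star_eq_sub hθ hy a b).symm, ⟨a, b, rfl⟩⟩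

/-- `IsNormSqrt` transports along a ring homomorphism. -/
theorem isNormSqrt_map {F F' : Type*} [Field F] [Field F'] (f : F →+* F') {θ c : F}
    (h : IsNormSqrt θ c) : IsNormSqrt (f θ) (f c) := by
  obtain ⟨z, w, rfl⟩ := h
  exact ⟨f z, f w, by simp only [map_sub, map_mul, map_pow]⟩

end Norm

/-! ## «n and d₀ determine (V, ϕ)_v for every v ∈ h»: local congruence at every finite place -/

section Local

variable {K : Type*} [Field K] [NumberField K] [IsCMField K]
variable {θ : maximalRealSubfield K} {y : K}
  (hθ : algebraMap (maximalRealSubfield K) K θ = y ^ 2) (hy : complexConj K y ≠ y)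

include hθ hy in
/-- **Local congruence at every finite place from a global-norm determinant ratio:** if `det H' = c · det H` with
`c ∈ K⁺` a Hilbert norm form value `a² − θ b²` (a norm from `K`), then `(c, θ)_v = 1` at every finite place `v`
of `K⁺` (file 133), hence the localised matrices are congruent at every `v` (file 156). -/
theorem locallyCongruent_all_of_isNormSqrt {n : Type*} [Fintype n] [DecidableEq n] {H H' : Matrix n n K}
    (hH : H.IsHermitian) (hH' : H'.IsHermitian) (hdet : IsUnit H.det) (hdet' : IsUnit H'.det)
    {c : maximalRealSubfield K} (hc0 : c ≠ 0) (hcn : IsNormSqrt θ c)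
    (hc : H'.det = algebraMap (maximalRealSubfield K) K c * H.det)
    (v : HeightOneSpectrum (𝓞 (maximalRealSubfield K))) : LocallyCongruent K v H H' := by
  rw [← hilbertFin_eq_one_iff_locallyCongruent hθ hy v hH hH' hdet hdet' hc0 hc, hilbertFin_eq_one_iff]
  haveI : CharZero (v.adicCompletion (maximalRealSubfield K)) :=
    charZero_of_injective_algebraMap (algebraMap ℚ (v.adicCompletion (maximalRealSubfield K))).injective
  haveI : NeZero (2 : v.adicCompletion (maximalRealSubfield K)) := ⟨two_ne_zero⟩
  exact hilbertSolvable_of_isNormSqrt ((map_ne_zero _).mpr hc0) ((map_ne_zero _).mpr (theta_ne_zero hθ hy))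
    (isNormSqrt_map _ hcn)

include hθ hy in
/-- **Equal determinants ⇒ locally congruent at every finite place** (`c = 1`). -/
theorem locallyCongruent_all_of_det_eq {n : Type*} [Fintype n] [DecidableEq n] {H H' : Matrix n n K}
    (hH : H.IsHermitian) (hH' : H'.IsHermitian) (hdet : IsUnit H.det) (hdet' : IsUnit H'.det)
    (hdeq : H'.det = H.det) (v : HeightOneSpectrum (𝓞 (maximalRealSubfield K))) :
    LocallyCongruent K v H H' :=
  locallyCongruent_all_of_isNormSqrt hθ hy hH hH' hdet hdet' one_ne_zero ⟨1, 0, by ring⟩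
    (by rw [map_one, one_mul, hdeq]) v

end Local

/-! ## Shimura's Theorem 2.2 (i) in Gram form, from the Hasse principle alone -/

section Global

variable {K : Type*} [Field K] [NumberField K] [IsCMField K]

/-- **Same determinant class ⇒ locally congruent at every finite place**, datum-free: if
`det H' = z · star z · det H` for some `z ∈ K`, the localised matrices are congruent at every finite place of
`K⁺`. -/
theorem locallyCongruent_all_of_det_eq_mul_norm {n : Type*} [Fintype n] [DecidableEq n] {H H' : Matrix n n K}
    (hH : H.IsHermitian) (hH' : H'.IsHermitian) (hdet : IsUnit H.det) (hdet' : IsUnit H'.det)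
    (z : K) (hz : H'.det = z * star z * H.det) (v : HeightOneSpectrum (𝓞 (maximalRealSubfield K))) :
    LocallyCongruent K v H H' := by
  obtain ⟨θ, y, hθ, hy⟩ := exists_datum K
  obtain ⟨c, hc, hcn⟩ := exists_isNormSqrt_mul_star hθ hy z
  have hc0 : c ≠ 0 := by
    rintro rfl
    rw [map_zero] at hc
    apply hdet'.ne_zero
    rw [hz, ← hc, zero_mul]
  exact locallyCongruent_all_of_isNormSqrt hθ hy hH hH' hdet hdet' hc0 hcn (by rw [hc, hz]) v

/-- **Equal determinants ⇒ locally congruent at every finite place**, datum-free. -/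
theorem locallyCongruent_all_of_det_eq' {n : Type*} [Fintype n] [DecidableEq n] {H H' : Matrix n n K}
    (hH : H.IsHermitian) (hH' : H'.IsHermitian) (hdet : IsUnit H.det) (hdet' : IsUnit H'.det)
    (hdeq : H'.det = H.det) (v : HeightOneSpectrum (𝓞 (maximalRealSubfield K))) :
    LocallyCongruent K v H H' := by
  obtain ⟨θ, y, hθ, hy⟩ := exists_datum K
  exact locallyCongruent_all_of_det_eq hθ hy hH hH' hdet hdet' hdeq v

/-- **Shimura's Theorem 2.2 (i) in Gram form, from the Hasse principle:** two invertible hermitian Gram matrices of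
the same size over the CM field `K` with the same determinant class (`det H' = z · star z · det H`) and the same
signatures (congruent under every embedding `K → ℂ`) are congruent over `K` — from
`GrossBH2021_Thm3_1_uniqueness K n` (the Hasse principle, DISPLAYED) alone: the finite places by
`locallyCongruent_all_of_det_eq_mul_norm`, the real places by hypothesis. No selection rule, no `|D| ≤ 1`, no
reciprocity. -/
theorem isCongruent_of_det_eq_mul_norm {n : Type*} [Fintype n] [DecidableEq n] {H H' : Matrix n n K}
    (hH : H.IsHermitian) (hH' : H'.IsHermitian) (hdet : IsUnit H.det) (hdet' : IsUnit H'.det)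
    (z : K) (hz : H'.det = z * star z * H.det)
    (hreal : ∀ φ : K →+* ℂ, IsCongruent (H.map φ) (H'.map φ))
    (hLandherr : GrossBH2021_Thm3_1_uniqueness K n) : IsCongruent H H' :=
  hLandherr H H' hH hH' hdet hdet' (locallyCongruent_all_of_det_eq_mul_norm hH hH' hdet hdet' z hz) hreal

/-- The equal-determinant case of `isCongruent_of_det_eq_mul_norm`. -/
theorem isCongruent_of_det_eq {n : Type*} [Fintype n] [DecidableEq n] {H H' : Matrix n n K}
    (hH : H.IsHermitian) (hH' : H'.IsHermitian) (hdet : IsUnit H.det) (hdet' : IsUnit H'.det)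
    (hdeq : H'.det = H.det) (hreal : ∀ φ : K →+* ℂ, IsCongruent (H.map φ) (H'.map φ))
    (hLandherr : GrossBH2021_Thm3_1_uniqueness K n) : IsCongruent H H' :=
  hLandherr H H' hH hH' hdet hdet' (locallyCongruent_all_of_det_eq' hH hH' hdet hdet' hdeq) hreal

end Global

/-! ## The display implication: the Hasse-principle display gives seat t6-p5's classification display -/

section Display

variable {K : Type*} [Field K] [NumberField K] [IsCMField K]

/-- **THE DISPLAY IMPLICATION — `GrossBH2021_Thm3_1_uniqueness K (Fin 2)` implies `T6.Hyp.Shimura2008_Thm2_2_i K`:**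
for totally real non-zero `c₁ c₂ c₁' c₂'` with `c₁ c₂ = c₁' c₂' · z z̄` and equal sign sums under every
`φ : K → ℂ`, the diagonal Gram matrices `diag(c₁', c₂')`, `diag(c₁, c₂)` have the same determinant class and are
congruent over `ℂ` under every `φ` (file 158), hence congruent over `K` by `isCongruent_of_det_eq_mul_norm`, and
file 157 turns the congruence into the isometry `g` of the `pairForm`s. Shimura's own proof of Thm 2.2 (i), in the
kernel: the cell's two Landherr displays are one. -/
theorem shimura2008_Thm2_2_i_of_grossBH2021 (hLandherr : GrossBH2021_Thm3_1_uniqueness K (Fin 2)) :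
    Summit.Ventures.HodgeRepro2.T6.Hyp.Shimura2008_Thm2_2_i K := by
  intro c₁ c₂ c₁' c₂' h₁ h₂ h₁' h₂' hc₁ hc₂ hc₁' hc₂' hnorm hsign
  obtain ⟨z, _, hzz⟩ := hnorm
  have hH : (diagonal ![c₁', c₂']).IsHermitian := by
    refine isHermitian_diagonal_iff.mpr fun i => ?_
    fin_cases i
    · exact h₁'
    · exact h₂'
  have hH' : (diagonal ![c₁, c₂]).IsHermitian := by
    refine isHermitian_diagonal_iff.mpr fun i => ?_
    fin_cases i
    · exact h₁
    · exact h₂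
  have hdet : IsUnit (diagonal ![c₁', c₂']).det := by
    rw [det_diagonal, Fin.prod_univ_two]
    simp [hc₁', hc₂']
  have hdet' : IsUnit (diagonal ![c₁, c₂]).det := by
    rw [det_diagonal, Fin.prod_univ_two]
    simp [hc₁, hc₂]
  have hdz : (diagonal ![c₁, c₂]).det = z * star z * (diagonal ![c₁', c₂']).det := by
    rw [det_diagonal, det_diagonal, Fin.prod_univ_two, Fin.prod_univ_two]
    simp only [Matrix.cons_val_zero, Matrix.cons_val_one]
    linear_combination hzz
  exact exists_isometry_pairForm_of_isCongruent
    (isCongruent_of_det_eq_mul_norm hH hH' hdet hdet' z hdz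
      (fun φ => isCongruent_map_of_sign_add φ h₁ h₂ h₁' h₂' hc₁ hc₂ hc₁' hc₂' (hsign φ)) hLandherr)

end Display

end Summit.Ventures.HodgeRepro2.T5LandherrInvariants
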